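import Mathlib.NumberTheory.ArithmeticFunction.Moebius
import Mathlib.Analysis.Complex.Basic
import Literature.NumberTheory.LFunctions.MultiplicativeAutomatic
import HarnessLib

/-!
# Automatic sequences are orthogonal to the Möbius function (Müllner 2017)

Named fact (D-0014) vendored for route `PneNP/Mobius`, crux
`Summit.PneNP.PneNP.Theses.Mobius.LiouvilleDigitalPhases` (item stmt-PneNP-1107): the crux asks
for orthogonality of `λ` to ALL 𝔽₂-polynomial phases of degree `≤ (log₂ m)^c` in the binary
digits; the two regimes known in print are the degree-1 phases (Walsh characters: Green 2012,
Bourgain 2013 — `MoebiusWalshCircuits.lean`) and the AUTOMATIC digital phases (Thue–Morse,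
Rudin–Shapiro, block-additive forms, anything a finite automaton reading the digits computes),
which is Müllner's theorem below, stated over the tree's `q`-kernel definition of automaticity
`Literature.NumberTheory.LFunctions.IsAutomaticSeq` (`MultiplicativeAutomatic.lean`,
Klurman–Kurlberg 2019 Def. 1.1 = Allouche–Shallit 2003 Thm. 6.6.2).

* `Literature.NumberTheory.LFunctions.mullner_moebius_automatic`: for every `k ≥ 2` and every
  `k`-automatic `a : ℕ → ℂ`, `∑_{n ≤ N} a(n) μ(n) = o(N)` (Müllner 2017, Thm. 1.2, the case
  `ξ = a` of the symbolic flow), in `ε`–`N₀` form.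
* `Literature.NumberTheory.LFunctions.isAutomaticSeq_const`: non-vacuity of the hypothesis
  (constant sequences are `k`-automatic for every `k`).

## Sources
* C. Müllner, *Automatic sequences fulfill the Sarnak conjecture*, Duke Math. J. 166 (2017)
  3219–3290 = arXiv:1602.03042, Thm. 1.2 (read: held text pp. 1–3: "Let `μ` be the Möbius
  function, `(a_n)` be a complex valued automatic sequence and let `(X, S)` be the symbolic
  dynamical system associated with `(a_n)`. Then for all sequences `ξ(n) := f(Sⁿ(x))`, with
  `x ∈ X` and `f ∈ C(X, ℂ)`, we have `∑_{n ≤ N} ξ(n) μ(n) = o(N)`.").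
* J.-P. Allouche, J. Shallit, *Automatic Sequences*, CUP 2003, Thm. 6.6.2 (kernel-finiteness
  `⇔` automatic).

## Design choices
* The fact is the instance `x = a`, `f` = the `0`-th coordinate projection (continuous on the
  subshift) of Thm. 1.2, i.e. `ξ(n) = a_n`; no rate is printed for Thm. 1.2, hence the `ε`–`N₀`
  form; the sum over `n ≤ N` is `Finset.range (N + 1)` (`μ 0 = 0` in Mathlib).
* `k ≥ 2` is necessary (for `k ≤ 1` every sequence has finite `k`-kernel in the sense of
  `IsAutomaticSeq`); kernel-finiteness for `k ≥ 2` forces a finite range, matching Müllner's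
  finite-alphabet setting.
* NOT here: the Liouville variant (`λ = μ * 1_{squares}`; routine but not printed in the source),
  the prime number theorem for automatic sequences (Müllner Thm. 1.3), any quantitative rate.
-/

open Finset

namespace Literature.NumberTheory.LFunctions

/-- Non-vacuity of `IsAutomaticSeq`: a constant sequence is `q`-automatic for every `q` (its
`q`-kernel is contained in the singleton `{f}`). [folklore] -/
theorem isAutomaticSeq_const (q : ℕ) (c : ℂ) : IsAutomaticSeq q (fun _ : ℕ => c) := by
  refine (Set.finite_singleton (fun _ : ℕ => c)).subset ?_
  rintro g ⟨i, -, r, -, rfl⟩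
  simp

/-- **Automatic sequences are orthogonal to the Möbius function** (Müllner 2017, Thm. 1.2: for a
complex-valued automatic sequence `(a_n)`, every point `x` of the subshift `X` it generates and
every `f ∈ C(X, ℂ)`, `∑_{n ≤ N} f(Sⁿ x) μ(n) = o(N)`; vendored in the case `x = a`, `f` = the
`0`-th coordinate, i.e. `ξ(n) = a_n`): for every `k ≥ 2` and every `k`-automatic `a : ℕ → ℂ`
(finite `k`-kernel, `IsAutomaticSeq k a`), `∑_{n ≤ N} a(n) μ(n) = o(N)`, in `ε`–`N₀` form. This
covers the Thue–Morse and Rudin–Shapiro phases of the binary digits (Mauduit–Rivat) and every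
other digital phase computed by a finite automaton — the "automatic degree-2 phases" below crux
`Summit.PneNP.PneNP.Theses.Mobius.LiouvilleDigitalPhases` (item stmt-PneNP-1107), which asks for
all 𝔽₂-polynomial phases of degree `≤ (log₂ m)^c` and is stated for `λ` rather than `μ`.
[cite: Mullner2017, Thm. 1.2 (case ξ = a)] -/
def mullner_moebius_automatic : Prop :=
  ∀ k : ℕ, 2 ≤ k → ∀ a : ℕ → ℂ, IsAutomaticSeq k a → ∀ ε : ℝ, 0 < ε → ∃ N₀ : ℕ, ∀ N : ℕ, N₀ ≤ N →
    ‖∑ n ∈ range (N + 1), a n * (ArithmeticFunction.moebius n : ℂ)‖ ≤ ε * N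

end Literature.NumberTheory.LFunctions
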